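import Summits.CriticalPhenomena.PercolationContinuityZ3.Theorems.PercNearOneGluingNoHeavyLowerTailQuantitativeS5FloorTransferFar
import HarnessLib

/-!
# ROW M2-R45: the explicit (S5) floor is complete for every monotone functional at every compatible rank — NO connectivity hypothesis

Support file (`--supports stmt-CriticalPhenomena-4575`), prover seat `prim-rate-mine-2` (lane prim-rate, constants-miner (c), BENCH row
M2-R45; `run/shared/lean/prim/prim-rate/prim-rate-mine-2/PROOFS.md` §P45).  No definitions, no named facts, no sorries; standard axioms.

Rows M2-R30 / M2-R41 (`CSH.s5dMargin_nil_pos_iff_exists_compat_rank_floor_pos_general`) assumed every relay joined to the minimal relay in the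
support graph (`…_of_preconnected`: a preconnected support).  Here the support `E` of the non-degenerate weights is ARBITRARY: relays in
components of `(V, E)` not containing the observer `o` are invisible to the margin (`CSH.s5dMargin_nil_eq_of_far`) and to every summand of the
explicit floor indexed by a near relay (`CSH.floor_pos_of_far`), and the gates-first mechanism runs on the near relays `S = {t ∈ T | o ⇝ t}`.

* `CSH.exists_compat_rank_floor_pos_far` — **`0 < s5dMargin w T r [] o v F` ⟹ some injective rank `r'` on `T`, compatible with the means ON
  ALL OF `T`, has `0 < FLOOR_T(r')`.**  Either a gate `g` of the observer's pocket is joined in `(V, E)` to a relay of smaller mean (then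
  `r' = r`, `CSH.floor_pos_of_gate_lt`), or every gate has the minimal mean `m₀` of the near relays and no far relay of smaller mean is joined
  to it; then the THREE-BLOCK rank `r' = r` on `{m < m₀}` (far relays only), `r + C` on the gates, `r + 2C` on the rest is injective, compatible
  on `T`, gates-first on `S`, with the same margin; `CSH.floor_pos_of_gatesFirst` on `S` and `CSH.floor_pos_of_far` give `0 < FLOOR_T(r')`;
* `CSH.s5dMargin_nil_pos_iff_exists_compat_rank_floor_pos_far` — **ROW M2-R30 / M2-R41 AS TYPED on an arbitrary support**;
* `CSH.s5dMargin_nil_eq_zero_iff_forall_compat_rank_floor_eq_zero_far` — the general-`F` ZERO SET of (S5) on an arbitrary support: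
  `margin = 0 ↔ FLOOR_T(r') = 0` at every compatible injective `r'`.

The census of the lane (`census/g10/disc`, kit j183126: two-component supports `n ≤ 6`, 665,562 instances, 0 mismatches) asked for exactly this.
[cite: KozmaNitzan2024, Conj. 4 (p. 32)] [cite: Harris1960, Lemma 4.1 (p. 16)] [cite: VandenbergHaggstromKahn2005, §2.1 (pp. 9–13)]
-/

noncomputable section

namespace Summit.CriticalPhenomena.PercolationContinuityZ3.Theorems

open MeasureTheory Set Literature.Probability.LatticeModels Literature.Probability.Percolation
open scoped Classical
open KNPreFKG

namespace CSH

variable {n : ℕ}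

/-- **`0 < margin` ⟹ some compatible injective rank has a positive floor, on an ARBITRARY support** (row M2-R45; every monotone `F ≥ 0`).
Weights non-degenerate on their support `E`; `o ≠ v` off `T`; `r` injective on `T` and compatible with the means of `F` on `T`.  The witness
rank is `r` itself when a gate of the observer's pocket is joined to a relay of smaller mean, and the three-block gates-first rank otherwise.
[cite: KozmaNitzan2024, Conj. 4 (p. 32)] [cite: Harris1960, Lemma 4.1 (p. 16)] -/
theorem exists_compat_rank_floor_pos_far (w : Sym2 (Fin n) → unitInterval) (E : Set (Sym2 (Fin n)))
    (hE0 : ∀ f, f ∉ E → (w f : ℝ) = 0) (hE1 : ∀ f ∈ E, 0 < (w f : ℝ) ∧ (w f : ℝ) < 1)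
    (T : Finset (Fin n)) (r : Fin n → ℕ) (hr : Set.InjOn r ↑T)
    (o v : Fin n) (hoT : o ∉ T) (hvT : v ∉ T) (hov : o ≠ v)
    (F : Set (Fin n) → ℝ) (hF : ∀ S S' : Set (Fin n), S ⊆ S' → F S ≤ F S') (hF0 : ∀ S : Set (Fin n), 0 ≤ F S)
    (hcompat : ∀ a ∈ T, ∀ a' ∈ T, r a < r a' →
      ∫ ω, F (openCluster ω a) ∂(prodBernoulli w) ≤ ∫ ω, F (openCluster ω a') ∂(prodBernoulli w))
    (hpos : 0 < s5dMargin w T r [] o v F) :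
    ∃ r' : Fin n → ℕ, Set.InjOn r' ↑T ∧
      (∀ a ∈ T, ∀ a' ∈ T, r' a < r' a' →
        ∫ ω, F (openCluster ω a) ∂(prodBernoulli w) ≤ ∫ ω, F (openCluster ω a') ∂(prodBernoulli w)) ∧
      0 < ∑ a ∈ T, (rankGain w T r' F a * avoidConst w a ((↑(T.erase a) : Set (Fin n)) ∪ ({d | d ∈ ([] : List (Fin n))} ∪ {v})) o +
        (∏ e ∈ Finset.univ.filter (fun e : Sym2 (Fin n) => ∃ y ∈ (↑(T.filter (fun b => r' b < r' a)) : Set (Fin n)), y ∈ e), (1 - (w e : ℝ))) *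
          ((∫ η in ((⋃ t ∈ (insert a (T.filter (fun b => r' a < r' b) ∪ (([] : List (Fin n))).toFinset)), openConn o t) ∪ openConn o v),
              F {c | c = a ∨ ∃ e ∈ openEdgeCluster η a, c ∈ e}
              ∂(prodBernoulli fun e => if (∃ y ∈ (↑(T.filter (fun b => r' b < r' a)) : Set (Fin n)), y ∈ e) then (0 : unitInterval) else w e)) -
            (prodBernoulli fun e => if (∃ y ∈ (↑(T.filter (fun b => r' b < r' a)) : Set (Fin n)), y ∈ e) then (0 : unitInterval) else w e).real
                ((⋃ t ∈ (insert a (T.filter (fun b => r' a < r' b) ∪ (([] : List (Fin n))).toFinset)), openConn o t) ∪ openConn o v) *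
              (∫ η, F {c | c = a ∨ ∃ e ∈ openEdgeCluster η a, c ∈ e}
                ∂(prodBernoulli fun e => if (∃ y ∈ (↑(T.filter (fun b => r' b < r' a)) : Set (Fin n)), y ∈ e) then (0 : unitInterval) else w e)))) := by
  set μ := prodBernoulli w with hμ
  set m : Fin n → ℝ := fun c => ∫ ω, F (openCluster ω c) ∂μ with hmdef
  -- the near relays
  set S : Finset (Fin n) := T.filter (fun t => (openGraph E).Reachable o t) with hSdef
  have hST : S ⊆ T := Finset.filter_subset _ _
  have hnear : ∀ t ∈ S, (openGraph E).Reachable o t := fun t ht => (Finset.mem_filter.1 ht).2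
  have hfar : ∀ t ∈ T, t ∉ S → ¬ (openGraph E).Reachable o t := fun t ht htS h => htS (Finset.mem_filter.2 ⟨ht, h⟩)
  have hrS : Set.InjOn r ↑S := hr.mono (Finset.coe_subset.2 hST)
  have hcompatS : ∀ a ∈ S, ∀ a' ∈ S, r a < r a' → m a ≤ m a' := fun a ha a' ha' h => hcompat a (hST ha) a' (hST ha') h
  have hoS : o ∉ S := fun h => hoT (hST h)
  have hvS : v ∉ S := fun h => hvT (hST h)
  have hposS : 0 < s5dMargin w S r [] o v F := by
    rw [← s5dMargin_nil_eq_of_far w E hE0 S T hST r o v F hfar]; exact hpos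
  have hSne : S.Nonempty := by
    rw [Finset.nonempty_iff_ne_empty]
    intro hS0
    have h0 := s5dMargin_nil_eq_zero_of_forall_relay_not_reachable w E hE0 T r F o v
      (fun t ht => hfar t ht (by rw [hS0]; exact Finset.notMem_empty t))
    linarith
  -- the observer's pocket and its gates (with respect to `T`)
  set E0 : Set (Sym2 (Fin n)) := {f | f ∈ E ∧ ∀ z ∈ f, z ∉ T ∧ z ≠ v} with hE0def
  set K : Set (Fin n) := {y | (openGraph E0).Reachable o y} with hKdef
  have hKprop : ∀ y ∈ K, y ∉ T ∧ y ≠ v := by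
    intro y hy
    exact forall_reachable_of_edges (S := E0) (fun z => z ∉ T ∧ z ≠ v) ⟨hoT, hov⟩ (fun f hf z hz => hf.2 z hz) hy
  have hoK : o ∈ K := SimpleGraph.Reachable.refl _
  have hvK : v ∉ K := fun h => (hKprop v h).2 rfl
  have hTK : ∀ t ∈ T, t ∉ K := fun t ht htK => (hKprop t htK).1 ht
  have hSK : ∀ t ∈ S, t ∉ K := fun t ht => hTK t (hST ht)
  have hKnear : ∀ y ∈ K, (openGraph E).Reachable o y := fun y hy =>
    SimpleGraph.Reachable.mono (BHK2006.openGraph_le fun f hf => hf.1) hy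
  have hKconn : ∀ y ∈ K, (openGraph {f | f ∈ E ∧ ∀ z ∈ f, z ∈ K}).Reachable o y := by
    intro y hy
    obtain ⟨W⟩ := (show (openGraph E0).Reachable o y from hy)
    refine QuantBHK.reachable_of_walk_edges_subset W fun g hg => ⟨(QuantBHK.mem_and_not_isDiag_of_mem_edges W hg).1.1, fun z hz => ?_⟩
    exact (W.takeUntil z (SimpleGraph.Walk.mem_support_of_mem_edges hg hz)).reachable
  set X : Finset (Fin n) := T.filter (fun t => ∃ y, y ∈ K ∧ s(y, t) ∈ E) with hXdef
  have hXT : ∀ g ∈ X, g ∈ T := fun g hg => (Finset.mem_filter.1 hg).1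
  have hXadj : ∀ g ∈ X, ∃ y ∈ K, s(y, g) ∈ E := fun g hg => by
    obtain ⟨y, hyK, hyg⟩ := (Finset.mem_filter.1 hg).2
    exact ⟨y, hyK, hyg⟩
  have hXS : ∀ g ∈ X, g ∈ S := by
    intro g hg
    obtain ⟨y, hyK, hyg⟩ := hXadj g hg
    have hyg' : y ≠ g := fun h => hTK g (hXT g hg) (h ▸ hyK)
    have hadj : (openGraph E).Adj y g := by rw [openGraph_adj]; exact ⟨hyg, hyg'⟩
    exact Finset.mem_filter.2 ⟨hXT g hg, (hKnear y hyK).trans hadj.reachable⟩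
  have hKexit : ∀ p q : Fin n, s(p, q) ∈ E → p ∈ K → q ∈ K ∨ q = v ∨ q ∈ (↑X : Set (Fin n)) := by
    intro p q hpq hp
    by_cases hqv : q = v
    · exact Or.inr (Or.inl hqv)
    by_cases hqT : q ∈ T
    · exact Or.inr (Or.inr (Finset.mem_coe.2 (Finset.mem_filter.2 ⟨hqT, p, hp, hpq⟩)))
    by_cases hpq' : p = q
    · exact Or.inl (hpq' ▸ hp)
    left
    have hadj : (openGraph E0).Adj p q := by
      rw [openGraph_adj]
      refine ⟨⟨hpq, fun z hz => ?_⟩, hpq'⟩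
      rcases Sym2.mem_iff.1 hz with rfl | rfl
      · exact hKprop _ hp
      · exact ⟨hqT, hqv⟩
    exact SimpleGraph.Reachable.trans hp hadj.reachable
  by_cases hA : ∃ g ∈ X, ∃ b ∈ T, m b < m g ∧ (openGraph E).Reachable g b
  · -- a gate joined to a relay of smaller mean: the given rank
    obtain ⟨g, hg, b, hb, hm, hgb⟩ := hA
    obtain ⟨y, hyK, hyg⟩ := hXadj g hg
    exact ⟨r, hr, hcompat, floor_pos_of_gate_lt w E hE0 hE1 T r hr b hb o v hoT hvT hov y g hyK (hXT g hg) hyg hgb F hF hF0 hcompat hm⟩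
  · -- every gate has the minimal near mean, no far relay of smaller mean is joined to a gate: the three-block gates-first rank
    push Not at hA
    obtain ⟨x₁, hx₁, hmin⟩ := Finset.exists_min_image S m hSne
    have hgate : ∀ g ∈ X, m g ≤ m x₁ := by
      intro g hg
      by_contra hlt
      exact hA g hg x₁ (hST hx₁) (lt_of_not_ge hlt) ((hnear g (hXS g hg)).symm.trans (hnear x₁ hx₁))
    have hSlow : ∀ t ∈ S, ¬ m t < m x₁ := fun t ht h => absurd (hmin t ht) (not_le.2 h)
    set C : ℕ := T.sup r + 1 with hC
    have hle : ∀ t ∈ T, r t < C := fun t ht => Nat.lt_succ_of_le (Finset.le_sup ht)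
    set rG : Fin n → ℕ := fun t => if m t < m x₁ then r t else if t ∈ X then r t + C else r t + 2 * C with hrG
    have hrG_low : ∀ t, m t < m x₁ → rG t = r t := fun t ht => by simp only [hrG, if_pos ht]
    have hrG_X : ∀ t ∈ X, rG t = r t + C := fun t ht => by simp only [hrG, if_neg (hSlow t (hXS t ht)), if_pos ht]
    have hrG_rest : ∀ t, ¬ m t < m x₁ → t ∉ X → rG t = r t + 2 * C := fun t ht htX => by simp only [hrG, if_neg ht, if_neg htX]
    have hrG : Set.InjOn rG ↑T := by
      intro a ha b hb hab
      have ha' := Finset.mem_coe.1 ha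
      have hb' := Finset.mem_coe.1 hb
      have hCa := hle a ha'
      have hCb := hle b hb'
      by_cases hal : m a < m x₁ <;> by_cases hbl : m b < m x₁
      · rw [hrG_low a hal, hrG_low b hbl] at hab
        exact hr ha hb hab
      · rw [hrG_low a hal] at hab
        by_cases hbX : b ∈ X
        · rw [hrG_X b hbX] at hab; omega
        · rw [hrG_rest b hbl hbX] at hab; omega
      · rw [hrG_low b hbl] at hab
        by_cases haX : a ∈ X
        · rw [hrG_X a haX] at hab; omega
        · rw [hrG_rest a hal haX] at hab; omega
      · by_cases haX : a ∈ X <;> by_cases hbX : b ∈ X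
        · rw [hrG_X a haX, hrG_X b hbX] at hab
          exact hr ha hb (by omega)
        · rw [hrG_X a haX, hrG_rest b hbl hbX] at hab; omega
        · rw [hrG_rest a hal haX, hrG_X b hbX] at hab; omega
        · rw [hrG_rest a hal haX, hrG_rest b hbl hbX] at hab
          exact hr ha hb (by omega)
    have hcompatG : ∀ a ∈ T, ∀ a' ∈ T, rG a < rG a' → m a ≤ m a' := by
      intro a ha a' ha' hlt
      have hCa := hle a ha
      have hCa' := hle a' ha'
      by_cases hal : m a < m x₁ <;> by_cases ha'l : m a' < m x₁
      · rw [hrG_low a hal, hrG_low a' ha'l] at hlt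
        exact hcompat a ha a' ha' hlt
      · exact hal.le.trans (le_of_not_gt ha'l)
      · exfalso
        rw [hrG_low a' ha'l] at hlt
        by_cases haX : a ∈ X
        · rw [hrG_X a haX] at hlt; omega
        · rw [hrG_rest a hal haX] at hlt; omega
      · by_cases haX : a ∈ X <;> by_cases ha'X : a' ∈ X
        · rw [hrG_X a haX, hrG_X a' ha'X] at hlt
          exact hcompat a ha a' ha' (by omega)
        · exact (hgate a haX).trans (le_of_not_gt ha'l)
        · exfalso
          rw [hrG_rest a hal haX, hrG_X a' ha'X] at hlt; omega
        · rw [hrG_rest a hal haX, hrG_rest a' ha'l ha'X] at hlt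
          exact hcompat a ha a' ha' (by omega)
    have hrGS : Set.InjOn rG ↑S := hrG.mono (Finset.coe_subset.2 hST)
    have hcompatGS : ∀ a ∈ S, ∀ a' ∈ S, rG a < rG a' → m a ≤ m a' := fun a ha a' ha' h => hcompatG a (hST ha) a' (hST ha') h
    have hinv : ∀ t ∈ S, t ∉ X → ∀ g ∈ X, g ∈ S ∧ rG g < rG t := by
      intro t ht htX g hg
      refine ⟨hXS g hg, ?_⟩
      rw [hrG_X g hg, hrG_rest t (hSlow t ht) htX]
      have := hle g (hXT g hg)
      omega
    have hposG : 0 < s5dMargin w S rG [] o v F := by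
      rw [← s5dMargin_nil_eq_of_compat w S r rG o v F hrS hrGS hcompatS hcompatGS]; exact hposS
    have hfloorS := floor_pos_of_gatesFirst w E hE0 hE1 o v hov K hoK hvK hKconn X hKexit hXadj S rG [] F hrGS hoS hvS hSK List.nodup_nil
      (fun d hd => absurd hd List.not_mem_nil) (fun d hd => absurd hd List.not_mem_nil) hF hF0 hcompatGS hinv hposG
    exact ⟨rG, hrG, hcompatG, floor_pos_of_far w E hE0 hE1 S T hST o v rG F hF hF0 hcompatG hnear hfar hfloorS⟩

/-- **ROW M2-R30 / M2-R41 AS TYPED on an ARBITRARY support (row M2-R45).**  Weights non-degenerate on their support `E` (no connectivity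
hypothesis); `o ≠ v` off `T`; `r` injective on `T`, compatible with the means of the monotone nonnegative `F`.  Then
`0 < s5dMargin w T r [] o v F ↔ ∃ r'` injective on `T`, `m(F)`-compatible, with `0 < FLOOR_F(r')`.
[cite: KozmaNitzan2024, Conj. 4 (p. 32)] [cite: Harris1960, Lemma 4.1 (p. 16)] -/
theorem s5dMargin_nil_pos_iff_exists_compat_rank_floor_pos_far (w : Sym2 (Fin n) → unitInterval) (E : Set (Sym2 (Fin n)))
    (hE0 : ∀ f, f ∉ E → (w f : ℝ) = 0) (hE1 : ∀ f ∈ E, 0 < (w f : ℝ) ∧ (w f : ℝ) < 1)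
    (T : Finset (Fin n)) (r : Fin n → ℕ) (hr : Set.InjOn r ↑T)
    (o v : Fin n) (hoT : o ∉ T) (hvT : v ∉ T) (hov : o ≠ v)
    (F : Set (Fin n) → ℝ) (hF : ∀ S S' : Set (Fin n), S ⊆ S' → F S ≤ F S') (hF0 : ∀ S : Set (Fin n), 0 ≤ F S)
    (hcompat : ∀ a ∈ T, ∀ a' ∈ T, r a < r a' →
      ∫ ω, F (openCluster ω a) ∂(prodBernoulli w) ≤ ∫ ω, F (openCluster ω a') ∂(prodBernoulli w)) :
    0 < s5dMargin w T r [] o v F ↔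
      ∃ r' : Fin n → ℕ, Set.InjOn r' ↑T ∧
        (∀ a ∈ T, ∀ a' ∈ T, r' a < r' a' →
          ∫ ω, F (openCluster ω a) ∂(prodBernoulli w) ≤ ∫ ω, F (openCluster ω a') ∂(prodBernoulli w)) ∧
        0 < ∑ a ∈ T, (rankGain w T r' F a * avoidConst w a ((↑(T.erase a) : Set (Fin n)) ∪ ({d | d ∈ ([] : List (Fin n))} ∪ {v})) o +
        (∏ e ∈ Finset.univ.filter (fun e : Sym2 (Fin n) => ∃ y ∈ (↑(T.filter (fun b => r' b < r' a)) : Set (Fin n)), y ∈ e), (1 - (w e : ℝ))) *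
          ((∫ η in ((⋃ t ∈ (insert a (T.filter (fun b => r' a < r' b) ∪ (([] : List (Fin n))).toFinset)), openConn o t) ∪ openConn o v),
              F {c | c = a ∨ ∃ e ∈ openEdgeCluster η a, c ∈ e}
              ∂(prodBernoulli fun e => if (∃ y ∈ (↑(T.filter (fun b => r' b < r' a)) : Set (Fin n)), y ∈ e) then (0 : unitInterval) else w e)) -
            (prodBernoulli fun e => if (∃ y ∈ (↑(T.filter (fun b => r' b < r' a)) : Set (Fin n)), y ∈ e) then (0 : unitInterval) else w e).real
                ((⋃ t ∈ (insert a (T.filter (fun b => r' a < r' b) ∪ (([] : List (Fin n))).toFinset)), openConn o t) ∪ openConn o v) *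
              (∫ η, F {c | c = a ∨ ∃ e ∈ openEdgeCluster η a, c ∈ e}
                ∂(prodBernoulli fun e => if (∃ y ∈ (↑(T.filter (fun b => r' b < r' a)) : Set (Fin n)), y ∈ e) then (0 : unitInterval) else w e)))) := by
  have hw1r : ∀ e, (w e : ℝ) < 1 := by
    intro e
    by_cases he : e ∈ E
    · exact (hE1 e he).2
    · rw [hE0 e he]; norm_num
  have hw : ∀ e, w e < 1 := fun e => by
    have h := hw1r e
    exact Subtype.coe_lt_coe.1 (by simpa using h)
  constructor
  · exact exists_compat_rank_floor_pos_far w E hE0 hE1 T r hr o v hoT hvT hov F hF hF0 hcompat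
  · rintro ⟨r', hr', hcompat', hfloor⟩
    have hle := s5dMargin_ge_sum_rankGain_add_isolatedFloor_of_lt_one_of_compat w hw o v hov T r' F hF hF0 hr' hcompat' hoT hvT
    rw [s5dMargin_nil_eq_of_compat w T r r' o v F hr hr' hcompat hcompat']
    exact lt_of_lt_of_le hfloor hle

/-- **The general-`F` ZERO SET of (S5) on an ARBITRARY support (row M2-R45)**: weights non-degenerate on `E`, `o ≠ v` off `T`, `r` injective
on `T` and compatible with the means of the monotone nonnegative `F`.  Then `s5dMargin w T r [] o v F = 0 ↔ FLOOR_F(r') = 0` for EVERY compatible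
injective rank `r'`. [cite: KozmaNitzan2024, Conj. 4 (p. 32)] [cite: Harris1960, Lemma 4.1 (p. 16)] -/
theorem s5dMargin_nil_eq_zero_iff_forall_compat_rank_floor_eq_zero_far (w : Sym2 (Fin n) → unitInterval) (E : Set (Sym2 (Fin n)))
    (hE0 : ∀ f, f ∉ E → (w f : ℝ) = 0) (hE1 : ∀ f ∈ E, 0 < (w f : ℝ) ∧ (w f : ℝ) < 1)
    (T : Finset (Fin n)) (r : Fin n → ℕ) (hr : Set.InjOn r ↑T)
    (o v : Fin n) (hoT : o ∉ T) (hvT : v ∉ T) (hov : o ≠ v)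
    (F : Set (Fin n) → ℝ) (hF : ∀ S S' : Set (Fin n), S ⊆ S' → F S ≤ F S') (hF0 : ∀ S : Set (Fin n), 0 ≤ F S)
    (hcompat : ∀ a ∈ T, ∀ a' ∈ T, r a < r a' →
      ∫ ω, F (openCluster ω a) ∂(prodBernoulli w) ≤ ∫ ω, F (openCluster ω a') ∂(prodBernoulli w)) :
    s5dMargin w T r [] o v F = 0 ↔
      ∀ r' : Fin n → ℕ, Set.InjOn r' ↑T →
        (∀ a ∈ T, ∀ a' ∈ T, r' a < r' a' →
          ∫ ω, F (openCluster ω a) ∂(prodBernoulli w) ≤ ∫ ω, F (openCluster ω a') ∂(prodBernoulli w)) →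
        ∑ a ∈ T, (rankGain w T r' F a * avoidConst w a ((↑(T.erase a) : Set (Fin n)) ∪ ({d | d ∈ ([] : List (Fin n))} ∪ {v})) o +
        (∏ e ∈ Finset.univ.filter (fun e : Sym2 (Fin n) => ∃ y ∈ (↑(T.filter (fun b => r' b < r' a)) : Set (Fin n)), y ∈ e), (1 - (w e : ℝ))) *
          ((∫ η in ((⋃ t ∈ (insert a (T.filter (fun b => r' a < r' b) ∪ (([] : List (Fin n))).toFinset)), openConn o t) ∪ openConn o v),
              F {c | c = a ∨ ∃ e ∈ openEdgeCluster η a, c ∈ e}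
              ∂(prodBernoulli fun e => if (∃ y ∈ (↑(T.filter (fun b => r' b < r' a)) : Set (Fin n)), y ∈ e) then (0 : unitInterval) else w e)) -
            (prodBernoulli fun e => if (∃ y ∈ (↑(T.filter (fun b => r' b < r' a)) : Set (Fin n)), y ∈ e) then (0 : unitInterval) else w e).real
                ((⋃ t ∈ (insert a (T.filter (fun b => r' a < r' b) ∪ (([] : List (Fin n))).toFinset)), openConn o t) ∪ openConn o v) *
              (∫ η, F {c | c = a ∨ ∃ e ∈ openEdgeCluster η a, c ∈ e}
                ∂(prodBernoulli fun e => if (∃ y ∈ (↑(T.filter (fun b => r' b < r' a)) : Set (Fin n)), y ∈ e) then (0 : unitInterval) else w e)))) = 0 := by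
  have hw1r : ∀ e, (w e : ℝ) < 1 := by
    intro e
    by_cases he : e ∈ E
    · exact (hE1 e he).2
    · rw [hE0 e he]; norm_num
  have hw : ∀ e, w e < 1 := fun e => by
    have h := hw1r e
    exact Subtype.coe_lt_coe.1 (by simpa using h)
  have hiff := s5dMargin_nil_pos_iff_exists_compat_rank_floor_pos_far w E hE0 hE1 T r hr o v hoT hvT hov F hF hF0 hcompat
  -- at every compatible rank the floor is nonnegative and dominated by the margin
  have hfl : ∀ r' : Fin n → ℕ, Set.InjOn r' ↑T →
      (∀ a ∈ T, ∀ a' ∈ T, r' a < r' a' →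
        ∫ ω, F (openCluster ω a) ∂(prodBernoulli w) ≤ ∫ ω, F (openCluster ω a') ∂(prodBernoulli w)) →
      0 ≤ ∑ a ∈ T, (rankGain w T r' F a * avoidConst w a ((↑(T.erase a) : Set (Fin n)) ∪ ({d | d ∈ ([] : List (Fin n))} ∪ {v})) o +
        (∏ e ∈ Finset.univ.filter (fun e : Sym2 (Fin n) => ∃ y ∈ (↑(T.filter (fun b => r' b < r' a)) : Set (Fin n)), y ∈ e), (1 - (w e : ℝ))) *
          ((∫ η in ((⋃ t ∈ (insert a (T.filter (fun b => r' a < r' b) ∪ (([] : List (Fin n))).toFinset)), openConn o t) ∪ openConn o v),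
              F {c | c = a ∨ ∃ e ∈ openEdgeCluster η a, c ∈ e}
              ∂(prodBernoulli fun e => if (∃ y ∈ (↑(T.filter (fun b => r' b < r' a)) : Set (Fin n)), y ∈ e) then (0 : unitInterval) else w e)) -
            (prodBernoulli fun e => if (∃ y ∈ (↑(T.filter (fun b => r' b < r' a)) : Set (Fin n)), y ∈ e) then (0 : unitInterval) else w e).real
                ((⋃ t ∈ (insert a (T.filter (fun b => r' a < r' b) ∪ (([] : List (Fin n))).toFinset)), openConn o t) ∪ openConn o v) *
              (∫ η, F {c | c = a ∨ ∃ e ∈ openEdgeCluster η a, c ∈ e}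
                ∂(prodBernoulli fun e => if (∃ y ∈ (↑(T.filter (fun b => r' b < r' a)) : Set (Fin n)), y ∈ e) then (0 : unitInterval) else w e)))) ∧
      ∑ a ∈ T, (rankGain w T r' F a * avoidConst w a ((↑(T.erase a) : Set (Fin n)) ∪ ({d | d ∈ ([] : List (Fin n))} ∪ {v})) o +
        (∏ e ∈ Finset.univ.filter (fun e : Sym2 (Fin n) => ∃ y ∈ (↑(T.filter (fun b => r' b < r' a)) : Set (Fin n)), y ∈ e), (1 - (w e : ℝ))) *
          ((∫ η in ((⋃ t ∈ (insert a (T.filter (fun b => r' a < r' b) ∪ (([] : List (Fin n))).toFinset)), openConn o t) ∪ openConn o v),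
              F {c | c = a ∨ ∃ e ∈ openEdgeCluster η a, c ∈ e}
              ∂(prodBernoulli fun e => if (∃ y ∈ (↑(T.filter (fun b => r' b < r' a)) : Set (Fin n)), y ∈ e) then (0 : unitInterval) else w e)) -
            (prodBernoulli fun e => if (∃ y ∈ (↑(T.filter (fun b => r' b < r' a)) : Set (Fin n)), y ∈ e) then (0 : unitInterval) else w e).real
                ((⋃ t ∈ (insert a (T.filter (fun b => r' a < r' b) ∪ (([] : List (Fin n))).toFinset)), openConn o t) ∪ openConn o v) *
              (∫ η, F {c | c = a ∨ ∃ e ∈ openEdgeCluster η a, c ∈ e}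
                ∂(prodBernoulli fun e => if (∃ y ∈ (↑(T.filter (fun b => r' b < r' a)) : Set (Fin n)), y ∈ e) then (0 : unitInterval) else w e))))
        ≤ s5dMargin w T r [] o v F := by
    intro r' hr' hcompat'
    have hnn := fun a (ha : a ∈ T) => isolatedFloor_term_nonneg w o v T r' F hF hF0 hcompat' a ha
    refine ⟨Finset.sum_nonneg fun a ha => add_nonneg (hnn a ha).1 (hnn a ha).2, ?_⟩
    rw [s5dMargin_nil_eq_of_compat w T r r' o v F hr hr' hcompat hcompat']
    exact s5dMargin_ge_sum_rankGain_add_isolatedFloor_of_lt_one_of_compat w hw o v hov T r' F hF hF0 hr' hcompat' hoT hvT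
  constructor
  · intro h0 r' hr' hcompat'
    obtain ⟨h1, h2⟩ := hfl r' hr' hcompat'
    rw [h0] at h2
    exact le_antisymm h2 h1
  · intro hall
    obtain ⟨h1, h2⟩ := hfl r hr hcompat
    rcases (h1.trans h2).lt_or_eq with hlt | heq
    · obtain ⟨r', hr', hcompat', hpos⟩ := hiff.1 hlt
      rw [hall r' hr' hcompat'] at hpos
      exact absurd hpos (lt_irrefl 0)
    · exact heq.symm

end CSH

end Summit.CriticalPhenomena.PercolationContinuityZ3.Theorems

end
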